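import Literature.Topology.FourManifolds.CappellShanesonClassGroupFourteen
import HarnessLib

/-!
# The class group of the trace `15` field (discriminant `23377 = 97 · 241`) and Gompf's conjecture
# for the traces `15` and `-10` (Kim–Yamada 2023, Theorem B)

Serves the named fact
`Literature.Topology.FourManifolds.kimYamada2023_nonempty_diffeomorph_sphere_four_of_trace_mem_Icc`
(`CappellShaneson.lean`; M. H. Kim, S. Yamada, Kyungpook Math. J. 63 (2023) 373–411 =
arXiv:1707.03860, Cor. C), reduced in the tree to Gompf's topological leaves and Theorem B in matrix
form (`GompfConjectureForTrace n`) for the traces not yet proved. Like its siblings for the traces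
`12` and `14`, this file PROVES Theorem B for the trace `15` — the row `n = 15` of Kim–Yamada's
Table 2: `C(ℤ[Θ₁₅])` is covered by the representatives `(1, 1, 15)` and `(2, 5, 15)`, and the
non-trivial class moves by one Gompf move to the trace `10 = 15 - 5` (Lemma 6.1 / §6.1), where
Gompf's conjecture holds (Theorem A from the trace `-5`, Example 3.4) — and, by Theorem A, for
`-10 = 5 - 15`.

## The number theory

For a cubic number field `K` generated by a root `θ` of `f₁₅ = x³ - 15x² + 14x - 1`:

* `Δ(f₁₅) = 23377 = 97 · 241` is squarefree, so `𝓞 K = ℤ[θ]`, `d_K = 23377`, `⌊M_K⌋ ≤ 43`;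
* Dedekind–Kummer at `p ≤ 43` (Marcus, Ch. 3, Thm. 27): `2, 3, 7, 13, 17, 23, 37` are inert;
  `f₁₅ ≡ (x - 2)(x² + 2x + 3) (mod 5)` with the quadratic irreducible gives `𝔭₅ = (5, θ - 2)` and
  the degree-two prime `𝔮₂₅ = (5, θ² + 2θ + 3)` (general lemma
  `eq_span_pair_of_linear_mul_quadratic_of_sq`); unique roots `4, 23, 30, 38, 20` modulo
  `11, 29, 31, 41, 43`; and `f₁₅ ≡ (x - 9)(x - 10)(x - 15) (mod 19)`;
* relations with explicit cofactors: `𝔭₅² = (θ - 2)` (norm `25`), `𝔭₅ 𝔮₂₅ = (5)`,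
  `𝔭₅ 𝔭₁₁ = (3θ - 1)` (`55`), `𝔭₅ (19, θ - 9) = (2θ + 1)` (`95`), `(19, θ - 10) = (2θ - 1)` (`19`),
  `𝔭₅ (19, θ - 15) = (4θ - 3)` (`95`), `𝔭₅ 𝔭₂₉ = (θ² + θ - 1)` (`145`), `𝔭₃₁ = (θ + 1)` (`31`),
  `𝔭₅ 𝔭₄₁ = (θ + 3)` (`205`), `𝔭₅ 𝔭₄₃ = (θ² - 5θ + 1)` (`215`);
* hence every ideal class is `1` or `[𝔭₅]`, `[𝔭₅]² = 1` (`classGroup_mem_pair_fifteen`).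

Transport to `ℤ[X]/(f₁₅)` and Prop. 2.14 (`exists_isConj_standardCSMatrix_of_cover`): every
Cappell–Shaneson matrix of trace `15` is similar to `X_{1,1,15} = A₁₃` or to `X_{2,5,15}`, and
`X_{2,5,15} ∼_G X_{2,5,10} ∼ A₀`: `gompfConjectureForTrace_fifteen`,
`gompfConjectureForTrace_neg_ten`. No named fact is introduced (D-0026).

## References

* [KimYamada2023] M. H. Kim, S. Yamada, Kyungpook Math. J. 63 (2023) 373–411 (arXiv:1707.03860):
  §2.3 (Prop. 2.14), Example 3.4, §5 (Table 2), §6.1 (Lemma 6.1 and the proof of Thm. B), Thm. A.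
* [Marcus2018] D. A. Marcus, *Number Fields*, 2nd ed., Ch. 3, Thm. 27 (Dedekind–Kummer); Ch. 5,
  Cor. 2 of Thm. 37 (Minkowski bound).
-/

noncomputable section

open Set Polynomial Module NumberField Ideal
open scoped NumberField MatrixGroups nonZeroDivisors
open Literature.LinearAlgebra.Matrix

namespace Literature.Topology.FourManifolds

/-! ### Dedekind–Kummer at a prime where `f_a` is a linear times an irreducible quadratic factor -/

section LinearQuadratic

variable {K : Type*} [Field K] [NumberField K] {a : ℤ} {θ : K}

/-- **Primes above `p` when `f_a ≡ (x - c) g (mod p)` with `g` an irreducible quadratic**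
(`𝓞 K = ℤ[θ]`; Dedekind–Kummer): a prime above `p` is the degree-one prime `(p, θ - c)` or the
degree-two prime `(p, G(θ))`, `G` an integer lift of `g`. [cite: Marcus2018, Ch. 3, Thm. 27] -/
theorem eq_span_pair_of_linear_mul_quadratic_of_sq (hθ : aeval θ (csPoly a) = 0)
    (h3 : finrank ℚ K = 3) (hsq : ∀ r e : ℤ, csDisc a = r ^ 2 * e → 2 < |e| → IsUnit r)
    {p : ℕ} (hp : p.Prime) {c : ℤ} {G : ℤ[X]}
    (hGmon : (G.map (Int.castRingHom (ZMod p))).Monic)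
    (hGirr : Irreducible (G.map (Int.castRingHom (ZMod p))))
    (hfac : csPolyMod a p = (X - C (c : ZMod p)) * G.map (Int.castRingHom (ZMod p)))
    {P : Ideal (𝓞 K)} (hP : P ∈ primesOver (span {(p : ℤ)}) (𝓞 K)) :
    P = span {(p : 𝓞 K), thetaInt hθ - (c : 𝓞 K)} ∨
      P = span {(p : 𝓞 K), aeval (thetaInt hθ) G} := by
  haveI := Fact.mk hp
  obtain ⟨Qb, hirr, hmon, hdvd, -, hspan⟩ := exists_factor_of_mem_primesOver_of_sq hθ h3 hsq hp hP
  rw [hfac] at hdvd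
  rcases hirr.prime.dvd_or_dvd hdvd with hlin | hquad
  · left
    have hdeg1 : 1 ≤ Qb.natDegree := by
      rcases Nat.eq_zero_or_pos Qb.natDegree with h0 | h0
      · exact absurd (Polynomial.eq_one_of_monic_natDegree_zero hmon h0 ▸ isUnit_one) hirr.not_isUnit
      · exact h0
    have hQc : Qb = X - C (c : ZMod p) :=
      (Polynomial.eq_of_monic_of_dvd_of_natDegree_le hmon (monic_X_sub_C _) hlin
        (by rw [natDegree_X_sub_C]; exact hdeg1)).symm
    have hQb' : (X - C c : ℤ[X]).map (Int.castRingHom (ZMod p)) = Qb := by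
      rw [Polynomial.map_sub, map_X, map_C, eq_intCast, hQc]
    have hPeq := hspan (X - C c) hQb'
    simp only [map_sub, aeval_X, aeval_C, algebraMap_int_eq, Int.coe_castRingHom] at hPeq
    exact hPeq
  · right
    have hQG : Qb = G.map (Int.castRingHom (ZMod p)) :=
      eq_of_monic_of_associated hmon hGmon (hirr.associated_of_dvd hGirr hquad)
    exact hspan G hQG.symm

end LinearQuadratic

section Field

variable {K : Type*} [Field K] [NumberField K] {θ : K}

/-! ### Discriminant `23377` and `𝓞 K = ℤ[θ]` -/

/-- `Δ(f₁₅) = 15·13·12·10 - 23 = 23377`. [cite: KimYamada2023, §3 (Δ(fₙ) = n(n-2)(n-3)(n-5) - 23)] -/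
theorem csDisc_fifteen : csDisc 15 = 23377 := by
  decide

set_option maxRecDepth 4096 in
/-- `23377 = 97 · 241` is squarefree, so `Δ(f₁₅)` has no factorisation `r² e` with `|e| > 2`,
`r ≠ ±1`, and `𝓞 K = ℤ[θ]`. [folklore] -/
theorem csDisc_fifteen_sq : ∀ r e : ℤ, csDisc 15 = r ^ 2 * e → 2 < |e| → IsUnit r :=
  isUnit_of_eq_sq_mul (B := 152) (by decide) (by decide) (by decide)

/-- `d_K = 23377` for the trace `15` field. [folklore] -/
theorem discr_eq_fifteen (hθ : aeval θ (csPoly 15) = 0) (h3 : finrank ℚ K = 3) :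
    NumberField.discr K = 23377 := by
  rw [discr_eq_csDisc_of_sq hθ h3 csDisc_fifteen_sq, csDisc_fifteen]

/-- The cubic relation `θ³ - 15θ² + 14θ - 1 = 0` in `𝓞 K`. [folklore] -/
theorem thetaInt_rel_fifteen (hθ : aeval θ (csPoly 15) = 0) :
    (thetaInt hθ) ^ 3 - 15 * (thetaInt hθ) ^ 2 + 14 * thetaInt hθ - 1 = 0 := by
  have rel := thetaInt_rel hθ
  push_cast at rel
  linear_combination rel

/-! ### The primes of norm at most `43` (Dedekind–Kummer) -/

/-- The inert primes `2, 3, 7, 13, 17, 23, 37` (no root of `f₁₅`): every prime above them is `(p)`. [folklore] -/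
theorem eq_span_of_inert_fifteen (hθ : aeval θ (csPoly 15) = 0) (h3 : finrank ℚ K = 3) {p : ℕ}
    (hp : p = 2 ∨ p = 3 ∨ p = 7 ∨ p = 13 ∨ p = 17 ∨ p = 23 ∨ p = 37)
    {P : Ideal (𝓞 K)} (hP : P ∈ primesOver (span {(p : ℤ)}) (𝓞 K)) : P = span {(p : 𝓞 K)} := by
  rcases hp with rfl | rfl | rfl | rfl | rfl | rfl | rfl
  · exact eq_span_of_no_root_of_sq hθ h3 csDisc_fifteen_sq (by norm_num) hP (by decide)
  · exact eq_span_of_no_root_of_sq hθ h3 csDisc_fifteen_sq (by norm_num) hP (by decide)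
  · exact eq_span_of_no_root_of_sq hθ h3 csDisc_fifteen_sq (by norm_num) hP (by decide)
  · exact eq_span_of_no_root_of_sq hθ h3 csDisc_fifteen_sq (by norm_num) hP (by decide)
  · exact eq_span_of_no_root_of_sq hθ h3 csDisc_fifteen_sq (by norm_num) hP (by decide)
  · exact eq_span_of_no_root_of_sq hθ h3 csDisc_fifteen_sq (by norm_num) hP (by decide)
  · exact eq_span_of_no_root_of_sq hθ h3 csDisc_fifteen_sq (by norm_num) hP (by decide)

/-- The degree-one primes with a unique root: `𝔭₁₁ = (11, θ - 4)`, `𝔭₂₉ = (29, θ - 23)`,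
`𝔭₃₁ = (31, θ - 30)`, `𝔭₄₁ = (41, θ - 38)`, `𝔭₄₃ = (43, θ - 20)` are the only primes `P` above
`p = 11, 29, 31, 41, 43` with `p ^ {f_P} ≤ 43`. [folklore] -/
theorem eq_span_pair_of_unique_root_fifteen (hθ : aeval θ (csPoly 15) = 0) (h3 : finrank ℚ K = 3)
    {p : ℕ} {c₀ : ℤ}
    (hp : (p = 11 ∧ c₀ = 4) ∨ (p = 29 ∧ c₀ = 23) ∨ (p = 31 ∧ c₀ = 30) ∨ (p = 41 ∧ c₀ = 38) ∨
      (p = 43 ∧ c₀ = 20))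
    {P : Ideal (𝓞 K)} (hP : P ∈ primesOver (span {(p : ℤ)}) (𝓞 K)) (hle : p ^ P.inertiaDeg ℤ ≤ 43) :
    P = span {(p : 𝓞 K), thetaInt hθ - (c₀ : 𝓞 K)} := by
  rcases hp with ⟨rfl, rfl⟩ | ⟨rfl, rfl⟩ | ⟨rfl, rfl⟩ | ⟨rfl, rfl⟩ | ⟨rfl, rfl⟩
  · exact eq_span_pair_of_unique_root_of_sq hθ h3 csDisc_fifteen_sq (by norm_num) hP hle
      (by decide) (by norm_num)
  · exact eq_span_pair_of_unique_root_of_sq hθ h3 csDisc_fifteen_sq (by norm_num) hP hle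
      (by decide) (by norm_num)
  · exact eq_span_pair_of_unique_root_of_sq hθ h3 csDisc_fifteen_sq (by norm_num) hP hle
      (by decide) (by norm_num)
  · exact eq_span_pair_of_unique_root_of_sq hθ h3 csDisc_fifteen_sq (by norm_num) hP hle
      (by decide) (by norm_num)
  · exact eq_span_pair_of_unique_root_of_sq hθ h3 csDisc_fifteen_sq (by norm_num) hP hle
      (by decide) (by norm_num)

/-- `f₁₅ = (x - 2)(x² + 2x + 3) + 5(-3x² + 3x + 1)`: `f₁₅ ≡ (x - 2)(x² + 2x + 3) (mod 5)`. [folklore] -/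
theorem csPoly_fifteen_eq_five :
    csPoly 15 = (X - 2) * (X ^ 2 + 2 * X + 3) + 5 * (-3 * X ^ 2 + 3 * X + 1) := by
  simp only [csPoly, map_sub, map_one, map_ofNat]
  ring

/-- The integer lift `x² + 2x + 3` of the quadratic factor of `f₁₅` modulo `5` reduces to
`x² + 2x + 3 ∈ 𝔽₅[x]`. [folklore] -/
theorem map_quad_fifteen_five :
    (X ^ 2 + 2 * X + 3 : ℤ[X]).map (Int.castRingHom (ZMod 5)) = X ^ 2 + 2 * X + 3 := by
  simp only [Polynomial.map_add, Polynomial.map_mul, Polynomial.map_pow, map_X, Polynomial.map_ofNat]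

/-- `f₁₅ mod 5 = (x - 2)(x² + 2x + 3)`. [folklore] -/
theorem csPolyMod_fifteen_five :
    csPolyMod 15 5 = (X - C ((2 : ℤ) : ZMod 5)) *
      (X ^ 2 + 2 * X + 3 : ℤ[X]).map (Int.castRingHom (ZMod 5)) := by
  rw [csPolyMod, csPoly_fifteen_eq_five, Polynomial.map_add]
  have h5 : Polynomial.map (Int.castRingHom (ZMod 5)) (5 * (-3 * X ^ 2 + 3 * X + 1) : ℤ[X]) = 0 := by
    rw [Polynomial.map_mul, show (5 : ℤ[X]) = C 5 from rfl, Polynomial.map_C]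
    have : (Int.castRingHom (ZMod 5)) 5 = 0 := by decide
    rw [this, C_0, zero_mul]
  rw [h5, add_zero, map_quad_fifteen_five]
  simp only [Polynomial.map_mul, Polynomial.map_sub, map_X, Polynomial.map_ofNat, Int.cast_ofNat,
    map_ofNat, map_quad_fifteen_five]

/-- The quadratic factor `x² + 2x + 3` is monic over `𝔽₅`. [folklore] -/
theorem monic_quad_fifteen_five :
    ((X ^ 2 + 2 * X + 3 : ℤ[X]).map (Int.castRingHom (ZMod 5))).Monic := by
  rw [map_quad_fifteen_five]
  monicity!

/-- `x² + 2x + 3` has no root modulo `5`. [folklore] -/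
theorem quad_fifteen_five_ne_zero : ∀ c : ZMod 5, c ^ 2 + 2 * c + 3 ≠ 0 := by
  decide

/-- The quadratic factor `x² + 2x + 3` has no root modulo `5`, hence is irreducible over `𝔽₅`. [folklore] -/
theorem irreducible_quad_fifteen_five :
    Irreducible ((X ^ 2 + 2 * X + 3 : ℤ[X]).map (Int.castRingHom (ZMod 5))) := by
  haveI := Fact.mk Nat.prime_five
  rw [map_quad_fifteen_five]
  have hdeg : (X ^ 2 + 2 * X + 3 : (ZMod 5)[X]).natDegree = 2 := by compute_degree!
  refine irreducible_of_degree_le_three_of_not_isRoot (by rw [hdeg]; decide) fun c hc =>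
    quad_fifteen_five_ne_zero c ?_
  have h := hc
  rw [IsRoot.def] at h
  simpa using h

/-- **The primes above `5`**: `𝔭₅ = (5, θ - 2)` (degree one) and `𝔮₂₅ = (5, θ² + 2θ + 3)` (degree two). [folklore] -/
theorem eq_P5_or_eq_Q5_fifteen (hθ : aeval θ (csPoly 15) = 0) (h3 : finrank ℚ K = 3)
    {P : Ideal (𝓞 K)} (hP : P ∈ primesOver (span {((5 : ℕ) : ℤ)}) (𝓞 K)) :
    P = span {(5 : 𝓞 K), thetaInt hθ - 2} ∨
      P = span {(5 : 𝓞 K), (thetaInt hθ) ^ 2 + 2 * thetaInt hθ + 3} := by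
  rcases eq_span_pair_of_linear_mul_quadratic_of_sq hθ h3 csDisc_fifteen_sq Nat.prime_five
    monic_quad_fifteen_five irreducible_quad_fifteen_five csPolyMod_fifteen_five hP with h | h
  · left; simpa using h
  · right
    simp only [map_add, map_mul, map_pow, aeval_X, map_ofNat] at h
    simpa using h

/-- `f₁₅ = (x - 9)(x - 10)(x - 15) + 19(x² - 19x + 71)`: `19` splits completely. [folklore] -/
theorem csPoly_fifteen_eq_nineteen :
    csPoly 15 = (X - 9) * (X - 10) * (X - 15) + 19 * (X ^ 2 - 19 * X + 71) := by
  simp only [csPoly, map_sub, map_one, map_ofNat]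
  ring

/-- `f₁₅ mod 19 = (x - 9)(x - 10)(x - 15)`. [folklore] -/
theorem csPolyMod_fifteen_nineteen :
    csPolyMod 15 19 = (X - C ((9 : ℤ) : ZMod 19)) * (X - C ((10 : ℤ) : ZMod 19)) *
      (X - C ((15 : ℤ) : ZMod 19)) := by
  rw [csPolyMod, csPoly_fifteen_eq_nineteen, Polynomial.map_add]
  have h19 : Polynomial.map (Int.castRingHom (ZMod 19)) (19 * (X ^ 2 - 19 * X + 71) : ℤ[X]) = 0 := by
    rw [Polynomial.map_mul, show (19 : ℤ[X]) = C 19 from rfl, Polynomial.map_C]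
    have : (Int.castRingHom (ZMod 19)) 19 = 0 := by decide
    rw [this, C_0, zero_mul]
  rw [h19, add_zero]
  simp only [Polynomial.map_mul, Polynomial.map_sub, map_X, Polynomial.map_ofNat, Int.cast_ofNat,
    map_ofNat]

/-- **The primes above `19`**: `(19, θ - 9)`, `(19, θ - 10)`, `(19, θ - 15)`. [folklore] -/
theorem eq_P19_fifteen (hθ : aeval θ (csPoly 15) = 0) (h3 : finrank ℚ K = 3)
    {P : Ideal (𝓞 K)} (hP : P ∈ primesOver (span {((19 : ℕ) : ℤ)}) (𝓞 K)) :
    P = span {(19 : 𝓞 K), thetaInt hθ - 9} ∨ P = span {(19 : 𝓞 K), thetaInt hθ - 10} ∨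
      P = span {(19 : 𝓞 K), thetaInt hθ - 15} := by
  rcases eq_span_pair_of_split_of_sq hθ h3 csDisc_fifteen_sq (by norm_num)
    csPolyMod_fifteen_nineteen hP with h | h | h
  · left; simpa using h
  · right; left; simpa using h
  · right; right; simpa using h

/-! ### Relations among the small primes: explicit generators -/

/-- **`𝔭₅² = (θ - 2)`** (`N(θ - 2) = 25`): `θ - 2 = 25 + 7·5(θ - 2) + (11 - θ)(θ - 2)²`. In particular `[𝔭₅]² = 1`. [folklore] -/
theorem P5_mul_P5_fifteen (hθ : aeval θ (csPoly 15) = 0) :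
    span {(5 : 𝓞 K), thetaInt hθ - 2} * span {(5 : 𝓞 K), thetaInt hθ - 2} =
      span {thetaInt hθ - 2} := by
  have rel := thetaInt_rel_fifteen hθ
  set t := thetaInt hθ with ht
  exact span_pair_mul_span_pair_eq_span_singleton
    (δ₁ := t ^ 2 - 13 * t - 12) (δ₂ := 5)
    (δ₃ := 5) (δ₄ := t - 2)
    (u₁ := 1) (u₂ := 7) (u₃ := 0) (u₄ := -t + 11)
    (by linear_combination (-1 : 𝓞 K) * rel) (by ring)
    (by ring) (by ring)
    (by linear_combination (1 : 𝓞 K) * rel)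

/-- **`𝔭₅ 𝔮₂₅ = (5)`**, where `𝔮₂₅ = (5, θ² + 2θ + 3)` is the prime of degree two above `5` (`f₁₅ ≡ (x - 2)(x² + 2x + 3) (mod 5)`): `5 = 5(θ² + 2θ + 3) - (θ + 4)·5(θ - 2) - 2·25`. [folklore] -/
theorem P5_mul_Q5_fifteen (hθ : aeval θ (csPoly 15) = 0) :
    span {(5 : 𝓞 K), thetaInt hθ - 2} * span {(5 : 𝓞 K), thetaInt hθ ^ 2 + 2 * thetaInt hθ + 3} =
      span {5} := by
  have rel := thetaInt_rel_fifteen hθ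
  set t := thetaInt hθ with ht
  exact span_pair_mul_span_pair_eq_span_singleton
    (δ₁ := 5) (δ₂ := t ^ 2 + 2 * t + 3)
    (δ₃ := t - 2) (δ₄ := 3 * t ^ 2 - 3 * t - 1)
    (u₁ := -2) (u₂ := 1) (u₃ := -t - 4) (u₄ := 0)
    (by ring) (by ring)
    (by ring) (by linear_combination (1 : 𝓞 K) * rel)
    (by ring)

/-- **`𝔭₅ 𝔭₁₁ = (3θ - 1)`** (`N = -55`). [folklore] -/
theorem P5_mul_P11_fifteen (hθ : aeval θ (csPoly 15) = 0) :
    span {(5 : 𝓞 K), thetaInt hθ - 2} * span {(11 : 𝓞 K), thetaInt hθ - 4} =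
      span {3 * thetaInt hθ - 1} := by
  have rel := thetaInt_rel_fifteen hθ
  set t := thetaInt hθ with ht
  exact span_pair_mul_span_pair_eq_span_singleton
    (δ₁ := -9 * t ^ 2 + 132 * t - 82) (δ₂ := 3 * t ^ 2 - 44 * t + 29)
    (δ₃ := 3 * t ^ 2 - 44 * t + 31) (δ₄ := -t ^ 2 + 15 * t - 11)
    (u₁ := 1) (u₂ := 5) (u₃ := -2) (u₄ := 0)
    (by linear_combination (27 : 𝓞 K) * rel) (by linear_combination (-9 : 𝓞 K) * rel)
    (by linear_combination (-9 : 𝓞 K) * rel) (by linear_combination (3 : 𝓞 K) * rel)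
    (by ring)

/-- **`𝔭₅ (19, θ - 9) = (2θ + 1)`** (`N = 95`). [folklore] -/
theorem P5_mul_P19a_fifteen (hθ : aeval θ (csPoly 15) = 0) :
    span {(5 : 𝓞 K), thetaInt hθ - 2} * span {(19 : 𝓞 K), thetaInt hθ - 9} =
      span {2 * thetaInt hθ + 1} := by
  have rel := thetaInt_rel_fifteen hθ
  set t := thetaInt hθ with ht
  exact span_pair_mul_span_pair_eq_span_singleton
    (δ₁ := 4 * t ^ 2 - 62 * t + 87) (δ₂ := -2 * t ^ 2 + 31 * t - 41)
    (δ₃ := -2 * t ^ 2 + 31 * t - 34) (δ₄ := t ^ 2 - 15 * t + 16)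
    (u₁ := 3) (u₂ := 8) (u₃ := -2) (u₄ := 0)
    (by linear_combination (-8 : 𝓞 K) * rel) (by linear_combination (4 : 𝓞 K) * rel)
    (by linear_combination (4 : 𝓞 K) * rel) (by linear_combination (-2 : 𝓞 K) * rel)
    (by ring)

/-- **`𝔭₅ (19, θ - 15) = (4θ - 3)`** (`N = -95`). [folklore] -/
theorem P5_mul_P19c_fifteen (hθ : aeval θ (csPoly 15) = 0) :
    span {(5 : 𝓞 K), thetaInt hθ - 2} * span {(19 : 𝓞 K), thetaInt hθ - 15} =
      span {4 * thetaInt hθ - 3} := by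
  have rel := thetaInt_rel_fifteen hθ
  set t := thetaInt hθ with ht
  exact span_pair_mul_span_pair_eq_span_singleton
    (δ₁ := -16 * t ^ 2 + 228 * t - 53) (δ₂ := 12 * t ^ 2 - 171 * t + 41)
    (δ₃ := 4 * t ^ 2 - 57 * t + 18) (δ₄ := -3 * t ^ 2 + 43 * t - 14)
    (u₁ := -2) (u₂ := -3) (u₃ := 1) (u₄ := 0)
    (by linear_combination (64 : 𝓞 K) * rel) (by linear_combination (-48 : 𝓞 K) * rel)
    (by linear_combination (-16 : 𝓞 K) * rel) (by linear_combination (12 : 𝓞 K) * rel)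
    (by ring)

/-- **`𝔭₅ 𝔭₂₉ = (θ² + θ - 1)`** (`N = -145`). [folklore] -/
theorem P5_mul_P29_fifteen (hθ : aeval θ (csPoly 15) = 0) :
    span {(5 : 𝓞 K), thetaInt hθ - 2} * span {(29 : 𝓞 K), thetaInt hθ - 23} =
      span {thetaInt hθ ^ 2 + thetaInt hθ - 1} := by
  have rel := thetaInt_rel_fifteen hθ
  set t := thetaInt hθ with ht
  exact span_pair_mul_span_pair_eq_span_singleton
    (δ₁ := -31 * t ^ 2 + 448 * t - 193) (δ₂ := 24 * t ^ 2 - 347 * t + 152)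
    (δ₃ := 9 * t ^ 2 - 131 * t + 71) (δ₄ := -7 * t ^ 2 + 102 * t - 56)
    (u₁ := 8) (u₂ := 11) (u₃ := -1) (u₄ := 1)
    (by linear_combination (31 * t + 48) * rel) (by linear_combination (-24 * t - 37) * rel)
    (by linear_combination (-9 * t - 13) * rel) (by linear_combination (7 * t + 10) * rel)
    (by ring)

/-- **`𝔭₅ 𝔭₄₁ = (θ + 3)`** (`N = 205`). [folklore] -/
theorem P5_mul_P41_fifteen (hθ : aeval θ (csPoly 15) = 0) :
    span {(5 : 𝓞 K), thetaInt hθ - 2} * span {(41 : 𝓞 K), thetaInt hθ - 38} =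
      span {thetaInt hθ + 3} := by
  have rel := thetaInt_rel_fifteen hθ
  set t := thetaInt hθ with ht
  exact span_pair_mul_span_pair_eq_span_singleton
    (δ₁ := t ^ 2 - 18 * t + 68) (δ₂ := -t ^ 2 + 18 * t - 63)
    (δ₃ := -t ^ 2 + 18 * t - 27) (δ₄ := t ^ 2 - 17 * t + 25)
    (u₁ := -7) (u₂ := -8) (u₃ := 1) (u₄ := 0)
    (by linear_combination (-1 : 𝓞 K) * rel) (by linear_combination (1 : 𝓞 K) * rel)
    (by linear_combination (1 : 𝓞 K) * rel) (by linear_combination (-1 : 𝓞 K) * rel)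
    (by ring)

/-- **`𝔭₅ 𝔭₄₃ = (θ² - 5θ + 1)`** (`N = -215`). [folklore] -/
theorem P5_mul_P43_fifteen (hθ : aeval θ (csPoly 15) = 0) :
    span {(5 : 𝓞 K), thetaInt hθ - 2} * span {(43 : 𝓞 K), thetaInt hθ - 20} =
      span {thetaInt hθ ^ 2 - 5 * thetaInt hθ + 1} := by
  have rel := thetaInt_rel_fifteen hθ
  set t := thetaInt hθ with ht
  exact span_pair_mul_span_pair_eq_span_singleton
    (δ₁ := 37 * t ^ 2 - 546 * t + 391) (δ₂ := -17 * t ^ 2 + 251 * t - 181)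
    (δ₃ := -13 * t ^ 2 + 193 * t - 149) (δ₄ := 6 * t ^ 2 - 89 * t + 69)
    (u₁ := 5) (u₂ := 12) (u₃ := -1) (u₄ := 1)
    (by linear_combination (-37 * t + 176) * rel) (by linear_combination (17 * t - 81) * rel)
    (by linear_combination (13 * t - 63) * rel) (by linear_combination (-6 * t + 29) * rel)
    (by ring)

/-- **`(19, θ - 10) = (2θ - 1)` is principal** (`N(2θ - 1) = -19`). [folklore] -/
theorem P19b_eq_fifteen (hθ : aeval θ (csPoly 15) = 0) :
    span {(19 : 𝓞 K), thetaInt hθ - 10} = span {2 * thetaInt hθ - 1} := by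
  have rel := thetaInt_rel_fifteen hθ
  set t := thetaInt hθ with ht
  exact span_pair_eq_span_singleton (u := 1) (v := 2) (δ := -4 * t ^ 2 + 58 * t - 27)
    (ε := 2 * t ^ 2 - 29 * t + 14)
    (by ring) (by linear_combination (8 : 𝓞 K) * rel) (by linear_combination (-4 : 𝓞 K) * rel)

/-- **`𝔭₃₁ = (31, θ - 30) = (θ + 1)` is principal** (`N(θ + 1) = 31`). [folklore] -/
theorem P31_eq_fifteen (hθ : aeval θ (csPoly 15) = 0) :
    span {(31 : 𝓞 K), thetaInt hθ - 30} = span {thetaInt hθ + 1} := by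
  have rel := thetaInt_rel_fifteen hθ
  set t := thetaInt hθ with ht
  exact span_pair_eq_span_singleton (u := 1) (v := 1) (δ := t ^ 2 - 16 * t + 30)
    (ε := -t ^ 2 + 16 * t - 29)
    (by ring) (by linear_combination (-1 : 𝓞 K) * rel) (by linear_combination (1 : 𝓞 K) * rel)


/-! ### Every ideal class is `1` or `[𝔭₅]` -/

/-- `𝔭₅ = (5, θ - 2)` is a nonzero ideal. [folklore] -/
theorem P5_mem_nonZeroDivisors_fifteen (hθ : aeval θ (csPoly 15) = 0) :
    span {(5 : 𝓞 K), thetaInt hθ - 2} ∈ (Ideal (𝓞 K))⁰ := by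
  have h := span_pair_natCast_mem_nonZeroDivisors (K := K) (n := 5) (Nat.succ_ne_zero 4)
    (thetaInt hθ - 2)
  simp only [Nat.cast_ofNat] at h
  exact h

/-- **Every ideal class of the trace `15` field is `1` or `[𝔭₅]`, and `[𝔭₅]² = 1`** (class number
`≤ 2`). Proof: `d_K = 23377`, `⌊M_K⌋ ≤ 43`; the primes `P` above `p ≤ 43` with `p ^ {f_P} ≤ 43` are
the inert `(2), (3)`, the two primes `𝔭₅`, `𝔮₂₅` above `5`, `𝔭₁₁`, the three primes above `19`,
`𝔭₂₉, 𝔭₃₁, 𝔭₄₁, 𝔭₄₃` (`7, 13, 17, 23, 37` are inert), with the relations `𝔭₅² = (θ - 2)`,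
`𝔭₅ 𝔮₂₅ = (5)`, `𝔭₅ 𝔭₁₁ = (3θ - 1)`, `𝔭₅ (19, θ - 9) = (2θ + 1)`, `(19, θ - 10) = (2θ - 1)`,
`𝔭₅ (19, θ - 15) = (4θ - 3)`, `𝔭₅ 𝔭₂₉ = (θ² + θ - 1)`, `𝔭₃₁ = (θ + 1)`, `𝔭₅ 𝔭₄₁ = (θ + 3)`,
`𝔭₅ 𝔭₄₃ = (θ² - 5θ + 1)`. [cite: KimYamada2023, §6.1 (proof of Thm. B)] -/
theorem classGroup_mem_pair_fifteen (hθ : aeval θ (csPoly 15) = 0) (h3 : finrank ℚ K = 3)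
    (C : ClassGroup (𝓞 K)) :
    C = 1 ∨ C = ClassGroup.mk0 ⟨span {(5 : 𝓞 K), thetaInt hθ - 2}, P5_mem_nonZeroDivisors_fifteen hθ⟩ := by
  classical
  set c5 : ClassGroup (𝓞 K) :=
    ClassGroup.mk0 ⟨span {(5 : 𝓞 K), thetaInt hθ - 2}, P5_mem_nonZeroDivisors_fifteen hθ⟩ with hc5
  have rel := thetaInt_rel_fifteen hθ
  set t := thetaInt hθ with ht
  have hne : ∀ (x y : 𝓞 K) (n : ℕ), x * y = n → n ≠ 0 → x ≠ 0 := by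
    rintro x y n hxy hn rfl
    rw [zero_mul] at hxy
    exact hn (by exact_mod_cast hxy.symm)
  have hne1 : t - 2 ≠ 0 :=
    hne _ (t ^ 2 - 13 * t - 12) 25 (by push_cast; linear_combination (1 : 𝓞 K) * rel)
      (by norm_num)
  have hne2 : 3 * t - 1 ≠ 0 :=
    hne _ (-9 * t ^ 2 + 132 * t - 82) 55 (by push_cast; linear_combination (-27 : 𝓞 K) * rel)
      (by norm_num)
  have hne3 : 2 * t + 1 ≠ 0 :=
    hne _ (4 * t ^ 2 - 62 * t + 87) 95 (by push_cast; linear_combination (8 : 𝓞 K) * rel)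
      (by norm_num)
  have hne4 : 4 * t - 3 ≠ 0 :=
    hne _ (-16 * t ^ 2 + 228 * t - 53) 95 (by push_cast; linear_combination (-64 : 𝓞 K) * rel)
      (by norm_num)
  have hne5 : t ^ 2 + t - 1 ≠ 0 :=
    hne _ (-31 * t ^ 2 + 448 * t - 193) 145 (by push_cast; linear_combination (-31 * t - 48) * rel)
      (by norm_num)
  have hne6 : t + 3 ≠ 0 :=
    hne _ (t ^ 2 - 18 * t + 68) 205 (by push_cast; linear_combination (1 : 𝓞 K) * rel)
      (by norm_num)
  have hne7 : t ^ 2 - 5 * t + 1 ≠ 0 :=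
    hne _ (37 * t ^ 2 - 546 * t + 391) 215 (by push_cast; linear_combination (37 * t - 176) * rel)
      (by norm_num)
  have hsq : c5 * c5 = 1 := by
    have h : c5 = c5⁻¹ :=
      ClassGroup.mk0_eq_mk0_inv_iff.mpr ⟨t - 2, hne1, by simpa using P5_mul_P5_fifteen hθ⟩
    rwa [eq_inv_iff_mul_eq_one] at h
  let H : Subgroup (ClassGroup (𝓞 K)) := Subgroup.zpowers c5
  have hc5H : c5 ∈ H := Subgroup.mem_zpowers c5
  have hinv : ∀ (P Q : Ideal (𝓞 K)) (hP0 : P ∈ (Ideal (𝓞 K))⁰) (hQ0 : Q ∈ (Ideal (𝓞 K))⁰) (x : 𝓞 K),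
      x ≠ 0 → P * Q = span {x} → ClassGroup.mk0 ⟨P, hP0⟩ = (ClassGroup.mk0 ⟨Q, hQ0⟩)⁻¹ := by
    intro P Q hP0 hQ0 x hx hPQ
    exact ClassGroup.mk0_eq_mk0_inv_iff.mpr ⟨x, hx, by simpa using hPQ⟩
  have hprinc : ∀ (P : Ideal (𝓞 K)) (hP0 : P ∈ (Ideal (𝓞 K))⁰) (x : 𝓞 K), P = span {x} →
      ClassGroup.mk0 ⟨P, hP0⟩ ∈ H := by
    intro P hP0 x hPx
    have : ClassGroup.mk0 ⟨P, hP0⟩ = 1 :=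
      (ClassGroup.mk0_eq_one_iff hP0).mpr ⟨⟨x, by rw [hPx, submodule_span_eq]⟩⟩
    rw [this]
    exact H.one_mem
  have hP5 : span {(5 : 𝓞 K), t - 2} ∈ (Ideal (𝓞 K))⁰ := P5_mem_nonZeroDivisors_fifteen hθ
  have hpartner : ∀ (Q : Ideal (𝓞 K)) (hQ0 : Q ∈ (Ideal (𝓞 K))⁰) (x : 𝓞 K), x ≠ 0 →
      span {(5 : 𝓞 K), t - 2} * Q = span {x} → ClassGroup.mk0 ⟨Q, hQ0⟩ ∈ H := by
    intro Q hQ0 x hx hQ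
    rw [hinv Q _ hQ0 hP5 x hx (by rw [mul_comm]; exact hQ)]
    exact H.inv_mem hc5H
  -- Minkowski: `⌊M_K⌋ ≤ 43`
  have hd : ((|NumberField.discr K| : ℤ) : ℝ) ≤ (23377 : ℕ) := by
    rw [discr_eq_fifteen hθ h3]
    norm_num
  have hfloor := floor_minkowskiBound_le_cubic h3 hd (s := 153) (U := 43) (by norm_num)
    (by norm_num) (by norm_num)
  have htop : H = ⊤ := by
    refine classGroup_subgroup_eq_top_of_primesOver H hfloor fun p hp hprime P hP0 hP hle => ?_
    have hpU : p ≤ 43 := (Finset.mem_Icc.mp hp).2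
    have h1p : 1 ≤ p := (Finset.mem_Icc.mp hp).1
    interval_cases p
    · exact absurd hprime (by decide)
    · exact hprinc P hP0 _ (eq_span_of_inert_fifteen hθ h3 (by norm_num) hP)
    · exact hprinc P hP0 _ (eq_span_of_inert_fifteen hθ h3 (by norm_num) hP)
    · exact absurd hprime (by decide)
    · -- `p = 5`
      rcases eq_P5_or_eq_Q5_fifteen hθ h3 hP with h5 | h5 <;> subst h5
      · exact hc5H
      · exact hpartner _ hP0 5 (by norm_num) (P5_mul_Q5_fifteen hθ)
    · exact absurd hprime (by decide)
    · exact hprinc P hP0 _ (eq_span_of_inert_fifteen hθ h3 (by norm_num) hP)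
    · exact absurd hprime (by decide)
    · exact absurd hprime (by decide)
    · exact absurd hprime (by decide)
    · -- `p = 11`
      have h := eq_span_pair_of_unique_root_fifteen hθ h3 (Or.inl ⟨rfl, rfl⟩) hP hle
      simp only [Nat.cast_ofNat, Int.cast_ofNat] at h
      subst h
      exact hpartner _ hP0 _ hne2 (P5_mul_P11_fifteen hθ)
    · exact absurd hprime (by decide)
    · exact hprinc P hP0 _ (eq_span_of_inert_fifteen hθ h3 (by norm_num) hP)
    · exact absurd hprime (by decide)
    · exact absurd hprime (by decide)
    · exact absurd hprime (by decide)
    · exact hprinc P hP0 _ (eq_span_of_inert_fifteen hθ h3 (by norm_num) hP)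
    · exact absurd hprime (by decide)
    · -- `p = 19`
      rcases eq_P19_fifteen hθ h3 hP with h | h | h <;> subst h
      · exact hpartner _ hP0 _ hne3 (P5_mul_P19a_fifteen hθ)
      · exact hprinc _ hP0 _ (P19b_eq_fifteen hθ)
      · exact hpartner _ hP0 _ hne4 (P5_mul_P19c_fifteen hθ)
    · exact absurd hprime (by decide)
    · exact absurd hprime (by decide)
    · exact absurd hprime (by decide)
    · exact hprinc P hP0 _ (eq_span_of_inert_fifteen hθ h3 (by norm_num) hP)
    · exact absurd hprime (by decide)
    · exact absurd hprime (by decide)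
    · exact absurd hprime (by decide)
    · exact absurd hprime (by decide)
    · exact absurd hprime (by decide)
    · -- `p = 29`
      have h := eq_span_pair_of_unique_root_fifteen hθ h3 (Or.inr (Or.inl ⟨rfl, rfl⟩)) hP hle
      simp only [Nat.cast_ofNat, Int.cast_ofNat] at h
      subst h
      exact hpartner _ hP0 _ hne5 (P5_mul_P29_fifteen hθ)
    · exact absurd hprime (by decide)
    · -- `p = 31`
      have h := eq_span_pair_of_unique_root_fifteen hθ h3 (Or.inr (Or.inr (Or.inl ⟨rfl, rfl⟩))) hP hle
      simp only [Nat.cast_ofNat, Int.cast_ofNat] at h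
      subst h
      exact hprinc _ hP0 _ (P31_eq_fifteen hθ)
    · exact absurd hprime (by decide)
    · exact absurd hprime (by decide)
    · exact absurd hprime (by decide)
    · exact absurd hprime (by decide)
    · exact absurd hprime (by decide)
    · exact hprinc P hP0 _ (eq_span_of_inert_fifteen hθ h3 (by norm_num) hP)
    · exact absurd hprime (by decide)
    · exact absurd hprime (by decide)
    · exact absurd hprime (by decide)
    · -- `p = 41`
      have h := eq_span_pair_of_unique_root_fifteen hθ h3
        (Or.inr (Or.inr (Or.inr (Or.inl ⟨rfl, rfl⟩)))) hP hle
      simp only [Nat.cast_ofNat, Int.cast_ofNat] at h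
      subst h
      exact hpartner _ hP0 _ hne6 (P5_mul_P41_fifteen hθ)
    · exact absurd hprime (by decide)
    · -- `p = 43`
      have h := eq_span_pair_of_unique_root_fifteen hθ h3
        (Or.inr (Or.inr (Or.inr (Or.inr ⟨rfl, rfl⟩)))) hP hle
      simp only [Nat.cast_ofNat, Int.cast_ofNat] at h
      subst h
      exact hpartner _ hP0 _ hne7 (P5_mul_P43_fifteen hθ)
  have hC : C ∈ H := by rw [htop]; exact Subgroup.mem_top C
  obtain ⟨k, rfl⟩ := Subgroup.mem_zpowers_iff.mp hC
  have h2 : c5 ^ (2 : ℤ) = 1 := by rw [zpow_two]; exact hsq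
  obtain ⟨j, rfl | rfl⟩ := Int.even_or_odd' k
  · left
    rw [zpow_mul, h2, one_zpow]
  · right
    rw [zpow_add, zpow_mul, h2, one_zpow, one_mul, zpow_one]

end Field

/-! ### The ideal classes of `ℤ[X]/(f₁₅)` and Gompf's conjecture for the traces `15` and `-10` -/

section Matrices

/-- **The ideal classes of `ℤ[Θ₁₅] = ℤ[X]/(f₁₅)`**: every non-zero ideal is in the class of
`⟨Θ - 1, 1⟩` or of `⟨Θ - 2, 5⟩` (the representatives `(1, 1, 15)`, `(2, 5, 15)` cover `C(ℤ[Θ₁₅])`). [cite: KimYamada2023, §6.1 (proof of Thm. B)] -/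
theorem ideal_class_adjoinRoot_fifteen (J : Ideal (AdjoinRoot (csPoly 15))) (hJ : J ≠ ⊥) :
    ∃ x y : AdjoinRoot (csPoly 15), x ≠ 0 ∧ y ≠ 0 ∧
      (span {x} * J = span {y} * csIdeal 1 1 15 ∨ span {x} * J = span {y} * csIdeal 2 5 15) := by
  classical
  set θ' := AdjoinRoot.root (csPolyQ 15) with hθ'
  have hθ : aeval θ' (csPoly 15) = 0 := aeval_root_csPoly 15
  have h3 : finrank ℚ (CSField 15) = 3 := finrank_CSField 15
  obtain ⟨e, he⟩ := exists_ringEquiv_adjoinRoot_of_sq hθ h3 csDisc_fifteen_sq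
  set I : Ideal (𝓞 (CSField 15)) := J.map e with hI
  have hIJ : I.map (e.symm : 𝓞 (CSField 15) →+* AdjoinRoot (csPoly 15)) = J := by
    rw [hI]
    exact Ideal.map_of_equiv e (I := J)
  have hI0 : I ≠ ⊥ := by
    intro h0
    apply hJ
    rw [← hIJ, h0, Ideal.map_bot]
  have hImem : I ∈ (Ideal (𝓞 (CSField 15)))⁰ := mem_nonZeroDivisors_iff_ne_zero.mpr hI0
  have hsymm : ∀ x, (e.symm : 𝓞 (CSField 15) →+* AdjoinRoot (csPoly 15)) (e x) = x :=
    fun x => e.symm_apply_apply x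
  have hP5 : (span {(5 : 𝓞 (CSField 15)), thetaInt hθ - 2}).map
      (e.symm : 𝓞 (CSField 15) →+* AdjoinRoot (csPoly 15)) = csIdeal 2 5 15 := by
    rw [Ideal.map_span, Set.image_insert_eq, Set.image_singleton, map_sub, ← he, hsymm, map_ofNat,
      map_ofNat, csIdeal, Set.pair_comm]
    simp
  rcases classGroup_mem_pair_fifteen hθ h3 (ClassGroup.mk0 ⟨I, hImem⟩) with h1 | h5
  · obtain ⟨z, hz⟩ := ((ClassGroup.mk0_eq_one_iff hImem).mp h1).principal
    have hz' : I = span {z} := by rw [hz, submodule_span_eq]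
    have hz0 : z ≠ 0 := by
      rintro rfl
      apply hI0
      rw [hz', Ideal.span_singleton_eq_bot]
    refine ⟨1, (e.symm : 𝓞 (CSField 15) →+* AdjoinRoot (csPoly 15)) z, one_ne_zero,
      (map_ne_zero_iff _ e.symm.injective).mpr hz0, Or.inl ?_⟩
    rw [Ideal.span_singleton_one, Ideal.top_mul, csIdeal_one_one, Ideal.mul_top, ← hIJ, hz',
      Ideal.map_span, Set.image_singleton]
  · obtain ⟨x, y, hx, hy, hxy⟩ := ClassGroup.mk0_eq_mk0_iff.mp h5
    refine ⟨(e.symm : 𝓞 (CSField 15) →+* AdjoinRoot (csPoly 15)) x,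
      (e.symm : 𝓞 (CSField 15) →+* AdjoinRoot (csPoly 15)) y,
      (map_ne_zero_iff _ e.symm.injective).mpr hx, (map_ne_zero_iff _ e.symm.injective).mpr hy,
      Or.inr ?_⟩
    have h := congrArg (Ideal.map (e.symm : 𝓞 (CSField 15) →+* AdjoinRoot (csPoly 15))) hxy
    simp only [Ideal.map_mul, Ideal.map_span, Set.image_singleton] at h
    rw [hIJ] at h
    rw [h, ← hP5, Ideal.map_span]

/-- `5 ∣ f₁₅(2) = -25`: `(2, 5, 15) ∈ 𝒞𝒮`. [cite: KimYamada2023, §6.1 (proof of Thm. B)] -/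
theorem five_dvd_eval_csPoly_fifteen_two : (5 : ℤ) ∣ (csPoly 15).eval 2 := by
  rw [eval_csPoly]; norm_num

/-- **Every Cappell–Shaneson matrix of trace `15` is similar to `X_{1,1,15} = A₁₃` or to
`X_{2,5,15}`** (Prop. 2.14). [cite: KimYamada2023, §6.1 (proof of Thm. B) and Prop. 2.14] -/
theorem isConj_standardCSMatrix_of_trace_eq_fifteen (A : SL(3, ℤ))
    (hdet : ((A : Matrix (Fin 3) (Fin 3) ℤ) - 1).det = 1)
    (htr : Matrix.trace (A : Matrix (Fin 3) (Fin 3) ℤ) = 15) :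
    IsConj A (standardCSMatrix 1 1 15 (one_dvd _)) ∨
      IsConj A (standardCSMatrix 2 5 15 five_dvd_eval_csPoly_fifteen_two) := by
  have hcover : ∀ J : Ideal (AdjoinRoot (csPoly 15)), J ≠ ⊥ →
      ∃ (c d : ℤ) (_ : d ∣ (csPoly 15).eval c) (x y : AdjoinRoot (csPoly 15)),
        x ≠ 0 ∧ y ≠ 0 ∧ Ideal.span {x} * J = Ideal.span {y} * csIdeal c d 15 ∧
          ((c = 1 ∧ d = 1) ∨ (c = 2 ∧ d = 5)) := by
    intro J hJ
    obtain ⟨x, y, hx, hy, hxy⟩ := ideal_class_adjoinRoot_fifteen J hJ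
    rcases hxy with h1 | h5
    · exact ⟨1, 1, one_dvd _, x, y, hx, hy, h1, Or.inl ⟨rfl, rfl⟩⟩
    · exact ⟨2, 5, five_dvd_eval_csPoly_fifteen_two, x, y, hx, hy, h5, Or.inr ⟨rfl, rfl⟩⟩
  obtain ⟨c, d, h, hconj, hcd⟩ := exists_isConj_standardCSMatrix_of_cover _ hcover A hdet htr
  rcases hcd with ⟨rfl, rfl⟩ | ⟨rfl, rfl⟩
  · exact Or.inl hconj
  · exact Or.inr hconj

/-- **Kim–Yamada 2023, Theorem B for the trace `15`, PROVED**: the non-trivial class `(2, 5, 15)`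
moves by one Gompf move to the trace `10 = 15 - 5`, where Gompf's conjecture holds (Theorem A from
the trace `-5`). [cite: KimYamada2023, Thm. B and §6.1] -/
theorem gompfConjectureForTrace_fifteen : GompfConjectureForTrace 15 := by
  intro A hdet htr
  rcases isConj_standardCSMatrix_of_trace_eq_fifteen A hdet htr with h1 | h5
  · exact (GompfEquiv.of_isConj h1).trans (gompfEquiv_standardCSMatrix_one_one 13 (one_dvd _))
  · exact (GompfEquiv.of_isConj h5).trans
      (gompfEquiv_standardCSMatrix_akbulutKirbyMatrix_of_modEq
        (gompfConjectureForTrace_ten_of aitchisonRubinstein1984_traceNegFiveClasses_holds)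
        five_dvd_eval_csPoly_fifteen_two (show (15 : ℤ) ≡ 10 [ZMOD 5] by decide))

/-- **Theorem B for the trace `-10`** (`= 5 - 15`), by Theorem A. [cite: KimYamada2023, Thm. A and Thm. B] -/
theorem gompfConjectureForTrace_neg_ten : GompfConjectureForTrace (-10) := by
  have h := gompfConjectureForTrace_of_five_sub gompfConjectureForTrace_fifteen
  norm_num at h
  exact h

end Matrices

end Literature.Topology.FourManifolds

end
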